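import Literature.NumberTheory.EllipticCurves.Sprung2012.ColemanMapLambdaActionProofs
import Summits.BirchSwinnertonDyer.BirchSwinnertonDyer.Theorems.SignedLowerHalvesSprungLowerHalfAtThreeChromaticCongruence
import HarnessLib

/-!
# Divisibility by `ω_n = (1+T)^{pⁿ} − 1` in `Λ = ℤ_p⟦T⟧` read on the basis `(1+T)ʲ`, `j < pⁿ`, of `Λ/ω_n`
# (route `PrintX8VS` / `PrintX8`, support item `InputHondaSystem` = stmt-BirchSwinnertonDyer-20413, named fact
# `Sprung2012.thm22_exists_isHondaSystem`; file 9 of the local series: the `Λ`-algebra behind the DUAL generation clauses of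
# `Sprung2012.IsHondaSystem`, whose pairing sums `P_{n,x}(z) = ∑_{j<pⁿ} z(gʲx)(1+T)ʲ` are read modulo `ω_n`)

HONEST FRAMING (desk `pub/bsd-wall/bsd-inputs`, seat `bsd-inputs-honda-p1`, D-0154 (2) INPUTS): THEOREMS ONLY — no definition, no
named fact, no instance, no `sorry`; commutative algebra of `Λ`; closes nothing by itself; BSD is not proved by any of this.

* §1 `Λ/ω_n` has no `p`-torsion: `ω_n ∣ p·x ⇒ ω_n ∣ x` (reduce modulo `p`: `ω_n ≡ T^{pⁿ}` and `𝔽_p⟦T⟧` is a domain; the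
  reduction lemmas are the tree's `Theorems.ChromaticCongruence.map_toZMod_*`).
* §2 the basis `(1+T)ʲ`, `j < pⁿ`: `ω_n ∣ ∑_{j<pⁿ} e_j (1+T)ʲ ⇒ e = 0` (Weierstrass division by the distinguished `ω_n`, tree
  `Sprung2012.omega_dvd_of_coe_dvd`, and a degree count), and its mod-`p` reading
  `ω_n ∣ p·y − ∑_{j<pⁿ} e_j (1+T)ʲ ⇒ p ∣ e_j`.

References: [Washington1997] L. Washington, *Introduction to Cyclotomic Fields*, §7.1 (Λ, distinguished polynomials), Prop. 7.2
(division); [Sprung2012] F. Sprung, J. Number Theory 132 (2012), Def. 3.1 (`Λ_n = Λ/ω_n`, `γ ↦ 1+T`).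
-/

set_option autoImplicit false
-- the Theorems namespace of this sub repeats the summit name by design (D-0017 nested layout)
set_option linter.dupNamespace false

noncomputable section

open scoped Classical
open Polynomial Finset

namespace Summit.BirchSwinnertonDyer.BirchSwinnertonDyer.Theorems

namespace SprungHonda

open Literature.NumberTheory.EllipticCurves Literature.NumberTheory.EllipticCurves.Sprung2017
  Literature.NumberTheory.EllipticCurves.Sprung2012

variable {p : ℕ} [hp : Fact p.Prime]

/-! ## §1 `Λ/ω_n` has no `p`-torsion -/

/-- **`Λ/ω_n` has no `p`-torsion**: `ω_n ∣ p·x ⇒ ω_n ∣ x` in `Λ = ℤ_p⟦T⟧` (`ω_n ≡ T^{pⁿ} (mod p)` and `𝔽_p⟦T⟧` is a domain, so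
`p·x = ω_n q` forces `p ∣ q`). [cite: Washington1997, Prop. 7.2] -/
theorem omega_dvd_of_omega_dvd_C_mul {n : ℕ} {x : PowerSeries ℤ_[p]}
    (h : toIwasawa p (cyclotomicOmega p n) ∣ PowerSeries.C (p : ℤ_[p]) * x) : toIwasawa p (cyclotomicOmega p n) ∣ x := by
  obtain ⟨q, hq⟩ := h
  -- reduce modulo `p`: `0 = T^{pⁿ} · q̄`, so `q̄ = 0`
  have hred := congrArg (PowerSeries.map (PadicInt.toZMod (p := p))) hq
  rw [map_mul, map_mul, ChromaticCongruence.map_toZMod_C_natCast, zero_mul, ChromaticCongruence.map_toZMod_cyclotomicOmega] at hred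
  have hq0 : PowerSeries.map (PadicInt.toZMod (p := p)) q = 0 :=
    (mul_eq_zero.mp hred.symm).resolve_left (pow_ne_zero _ PowerSeries.X_ne_zero)
  obtain ⟨q', rfl⟩ := (ChromaticCongruence.map_toZMod_eq_zero_iff q).mp hq0
  refine ⟨q', ?_⟩
  have hp0 : (PowerSeries.C (p : ℤ_[p])) ≠ 0 := by
    intro h0
    have h1 := congrArg PowerSeries.constantCoeff h0
    rw [PowerSeries.constantCoeff_C, map_zero] at h1
    exact (Nat.cast_ne_zero.mpr hp.out.ne_zero) h1
  rw [mul_left_comm] at hq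
  exact mul_left_cancel₀ hp0 hq

/-! ## §2 The basis `(1+T)ʲ`, `j < pⁿ`, of `Λ/ω_n` -/

/-- The combination `∑_{j<N} e_j (X+1)ʲ ∈ R[X]` is the Taylor shift of `∑_{j<N} e_j Xʲ`, so it vanishes only if every `e_j`
does. [folklore] -/
theorem forall_eq_zero_of_sum_C_mul_X_add_one_pow_eq_zero {R : Type*} [CommRing R] {N : ℕ} {e : ℕ → R}
    (h : ∑ j ∈ range N, C (e j) * (X + 1 : R[X]) ^ j = 0) : ∀ j < N, e j = 0 := by
  set g : R[X] := ∑ j ∈ range N, C (e j) * X ^ j with hg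
  have hcomp : g.comp (X + 1) = ∑ j ∈ range N, C (e j) * (X + 1 : R[X]) ^ j := by
    rw [hg, Polynomial.sum_comp]
    simp only [Polynomial.mul_comp, Polynomial.C_comp, Polynomial.pow_comp, Polynomial.X_comp]
  have hg0 : g = 0 := by
    have h1 : (g.comp (X + 1)).comp (X - 1) = 0 := by rw [hcomp, h, Polynomial.zero_comp]
    rwa [Polynomial.comp_assoc, Polynomial.add_comp, Polynomial.X_comp, Polynomial.one_comp, sub_add_cancel,
      Polynomial.comp_X] at h1
  intro j hj
  have := congrArg (fun q : R[X] ↦ q.coeff j) hg0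
  simp only [hg, Polynomial.finsetSum_coeff, Polynomial.coeff_C_mul_X_pow, Polynomial.coeff_zero] at this
  rw [Finset.sum_eq_single j (fun k _ hk ↦ if_neg (Ne.symm hk)) (fun hj' ↦ absurd (mem_range.mpr hj) hj')] at this
  simpa using this

/-- The combination `∑_{j<pⁿ} e_j (X+1)ʲ` has degree `< pⁿ`. [folklore] -/
theorem natDegree_sum_C_mul_X_add_one_pow_lt {R : Type*} [CommRing R] [Nontrivial R] (n : ℕ) (e : ℕ → R) :
    (∑ j ∈ range (p ^ n), C (e j) * (X + 1 : R[X]) ^ j).natDegree < p ^ n := by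
  have hp1 : 0 < p ^ n := pow_pos hp.out.pos n
  have hle : (∑ j ∈ range (p ^ n), C (e j) * (X + 1 : R[X]) ^ j).natDegree ≤ p ^ n - 1 := by
    refine Polynomial.natDegree_sum_le_of_forall_le (range (p ^ n)) (fun j ↦ C (e j) * (X + 1 : R[X]) ^ j) fun j hj ↦ ?_
    have hj' := mem_range.mp hj
    have hX1 : (X + 1 : R[X]).natDegree = 1 := by
      rw [← map_one (Polynomial.C (R := R))]; exact Polynomial.natDegree_X_add_C 1
    calc (C (e j) * (X + 1 : R[X]) ^ j).natDegree ≤ (C (e j)).natDegree + ((X + 1 : R[X]) ^ j).natDegree :=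
          Polynomial.natDegree_mul_le
      _ ≤ 0 + j * (X + 1 : R[X]).natDegree := by
          gcongr
          · exact (Polynomial.natDegree_C _).le
          · exact Polynomial.natDegree_pow_le
      _ ≤ p ^ n - 1 := by rw [hX1, zero_add, mul_one]; omega
  omega

/-- **`ω_n ∣ ∑_{j<pⁿ} e_j (1+T)ʲ` in `Λ` forces `e_j = 0` for all `j < pⁿ`**: by Weierstrass division (tree
`Sprung2012.omega_dvd_of_coe_dvd`) the monic `ω_n` of degree `pⁿ` divides the polynomial `∑ e_j (X+1)ʲ` of degree `< pⁿ` in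
`ℤ_p[X]`, which is therefore `0`. (`{(1+T)ʲ}_{j<pⁿ}` is a `ℤ_p`-basis of `Λ_n = Λ/ω_n ≅ ℤ_p[Γ/Γ^{pⁿ}]`.)
[cite: Washington1997, Prop. 7.2] [cite: Sprung2012, Def. 3.1 (Λ_n, γ ↦ 1+T)] -/
theorem forall_eq_zero_of_omega_dvd_sum {n : ℕ} {e : ℕ → ℤ_[p]}
    (h : toIwasawa p (cyclotomicOmega p n) ∣ ∑ j ∈ range (p ^ n), PowerSeries.C (e j) * (1 + PowerSeries.X) ^ j) :
    ∀ j < p ^ n, e j = 0 := by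
  set f : ℤ_[p][X] := ∑ j ∈ range (p ^ n), C (e j) * (X + 1 : ℤ_[p][X]) ^ j with hf
  have hcoe : (f : PowerSeries ℤ_[p]) = ∑ j ∈ range (p ^ n), PowerSeries.C (e j) * (1 + PowerSeries.X) ^ j := by
    rw [hf, ← Polynomial.coeToPowerSeries.ringHom_apply, map_sum]
    refine sum_congr rfl fun j _ ↦ ?_
    rw [map_mul, map_pow, map_add, map_one, Polynomial.coeToPowerSeries.ringHom_apply, Polynomial.coeToPowerSeries.ringHom_apply,
      Polynomial.coe_C, Polynomial.coe_X, add_comm]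
  rw [← hcoe, toIwasawa_cyclotomicOmega_eq_coe] at h
  have hdvd := omega_dvd_of_coe_dvd h
  have hX1 : (X + 1 : ℤ_[p][X]) = X + C 1 := by rw [map_one]
  have hdeg : ((X + 1 : ℤ_[p][X]) ^ p ^ n - 1).natDegree = p ^ n := by
    have hpow : ((X + 1 : ℤ_[p][X]) ^ p ^ n).natDegree = p ^ n := by
      rw [hX1, Polynomial.natDegree_pow, Polynomial.natDegree_X_add_C, mul_one]
    rw [Polynomial.natDegree_sub_eq_left_of_natDegree_lt] <;> rw [hpow]
    rw [Polynomial.natDegree_one]; exact pow_pos hp.out.pos n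
  have hf0 : f = 0 :=
    Polynomial.eq_zero_of_dvd_of_natDegree_lt hdvd (by rw [hdeg]; exact natDegree_sum_C_mul_X_add_one_pow_lt n e)
  exact forall_eq_zero_of_sum_C_mul_X_add_one_pow_eq_zero hf0

/-- **Mod-`p` reading**: `ω_n ∣ p·y − ∑_{j<pⁿ} e_j (1+T)ʲ` in `Λ` forces `p ∣ e_j` for all `j < pⁿ` (reduce modulo `p`:
`T^{pⁿ}` divides the polynomial `∑ ē_j (X+1)ʲ` of degree `< pⁿ` in `𝔽_p[X]`, which is therefore `0`).
[cite: Washington1997, Prop. 7.2] [cite: Sprung2012, Def. 3.1 (Λ_n, γ ↦ 1+T)] -/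
theorem forall_dvd_of_omega_dvd_C_mul_sub_sum {n : ℕ} {y : PowerSeries ℤ_[p]} {e : ℕ → ℤ_[p]}
    (h : toIwasawa p (cyclotomicOmega p n) ∣
      PowerSeries.C (p : ℤ_[p]) * y - ∑ j ∈ range (p ^ n), PowerSeries.C (e j) * (1 + PowerSeries.X) ^ j) :
    ∀ j < p ^ n, (p : ℤ_[p]) ∣ e j := by
  obtain ⟨q, hq⟩ := h
  set f : (ZMod p)[X] := ∑ j ∈ range (p ^ n), C (PadicInt.toZMod (e j)) * (X + 1 : (ZMod p)[X]) ^ j with hf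
  have hcoe : (f : PowerSeries (ZMod p)) =
      PowerSeries.map (PadicInt.toZMod (p := p)) (∑ j ∈ range (p ^ n), PowerSeries.C (e j) * (1 + PowerSeries.X) ^ j) := by
    rw [hf, ← Polynomial.coeToPowerSeries.ringHom_apply, map_sum, map_sum]
    refine sum_congr rfl fun j _ ↦ ?_
    rw [map_mul, map_pow, map_add, map_one, Polynomial.coeToPowerSeries.ringHom_apply, Polynomial.coeToPowerSeries.ringHom_apply,
      Polynomial.coe_C, Polynomial.coe_X, map_mul, map_pow, PowerSeries.map_C, map_add, map_one, PowerSeries.map_X, add_comm]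
  -- reduce modulo `p`: `T^{pⁿ} ∣ f` in `𝔽_p⟦T⟧`
  have hred := congrArg (PowerSeries.map (PadicInt.toZMod (p := p))) hq
  rw [map_sub, map_mul, ChromaticCongruence.map_toZMod_C_natCast, zero_mul, zero_sub, map_mul,
    ChromaticCongruence.map_toZMod_cyclotomicOmega, ← hcoe, neg_eq_iff_eq_neg, ← mul_neg] at hred
  have hXdvd : (PowerSeries.X : PowerSeries (ZMod p)) ^ p ^ n ∣ (f : PowerSeries (ZMod p)) := ⟨_, hred⟩
  -- so `f = 0` (degree `< pⁿ`)
  have hf0 : f = 0 := by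
    ext d
    rw [Polynomial.coeff_zero]
    by_cases hd : d < p ^ n
    · have := (PowerSeries.X_pow_dvd_iff.mp hXdvd) d hd
      rwa [Polynomial.coeff_coe] at this
    · exact Polynomial.coeff_eq_zero_of_natDegree_lt (lt_of_lt_of_le (natDegree_sum_C_mul_X_add_one_pow_lt n _) (by omega))
  intro j hj
  have hej : PadicInt.toZMod (e j) = 0 := forall_eq_zero_of_sum_C_mul_X_add_one_pow_eq_zero hf0 j hj
  have hmem : e j ∈ Ideal.span {(p : ℤ_[p])} := by
    rw [← PadicInt.maximalIdeal_eq_span_p, ← PadicInt.ker_toZMod, RingHom.mem_ker]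
    exact hej
  exact Ideal.mem_span_singleton.mp hmem

end SprungHonda

end Summit.BirchSwinnertonDyer.BirchSwinnertonDyer.Theorems

end
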